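import Literature.NumberTheory.EllipticCurves.ModularPolynomialLevelSevenNodes
import HarnessLib

/-!
# Double roots of the level-7 fibre, II: the split class-number-two bases `−48, −52`, and the value relation at `−75`

certified instances and evidence bearing on the general Hodge conjecture; no claim.

Topic `NumberTheory/EllipticCurves` (complex multiplication).  Theorem-only file (no definition, no named fact; D-0026), sequel to
`ModularPolynomialLevelSevenNodes.lean` (the device `derivative_fibre_eval_eq_zero_of_divPoint` and the bases `−20, −24, −40`),
same vocabulary and, for `−48` and `−52`, the same shape per base: four coset lemmas (two from each class, both landing in the other
class since `𝔭₇` is non-principal), the value relation `Φ₇(j₂, j₁) = 0` both ways and the derivative relation `∂Φ₇/∂X (j₂, j₁) = 0` both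
ways.  For `−75` (`7` split as well) only ONE coset and the value relation `Φ₇(j(τ_{(3,3,7)}), j(τ_{(1,1,19)})) = 0` are recorded: its node
relations are not needed — with `ModularPolynomialLevelSevenPoints.lean`, `…Nodes.lean` and this file the level-7 series has exactly 27
CM relations, which are independent on the 27 unknown coefficients of `Φ₇` (lit note PHI7-SCOPE; the split base `−115` of the tree is
likewise not needed).  PRINTED inputs as there [Cox2013, §11.B (11.14)–(11.15), Lemma 11.24, §11.A Thm. 11.2]; the reductions are OURS
(kernel-checked).

## References
* [Cox2013] D. A. Cox, *Primes of the form x² + ny²*, 2nd ed., Wiley (2013): §11.B (11.14)–(11.15), Lemma 11.24, §11.A Thm. 11.2, §7.B.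
-/

noncomputable section

open Complex Polynomial
open UpperHalfPlane hiding I
open scoped MatrixGroups

namespace Literature.NumberTheory.EllipticCurves

open ModularForms
open Literature.NumberTheory.QuadraticFields.Quadratic (BinQF)

namespace ModularPolynomialSeven

variable [Fact (Nat.Prime 7)]

/-! ### `D = -48`: forms `(1,0,12)` (principal) and `(3,0,4)` -/

/-- `j((τ_{(1,0,12)} + 3)/7) = j(τ_{(49,-42,21)}) = j(τ_{(7,-6,3)}) = j(τ_{(3,0,4)})` (`D = -48`).
[cite: Cox2013, §11.B Lemma 11.24 and §11.A Thm. 11.2] -/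
theorem conj_3_neg48 : kleinJ (divPoint 7 3 (heegnerTau (1, 0, 12))) = formJ (3, 0, 4) := by
  have h := divPoint_seven_heegnerTau_of_pos (a := 1) (b := 0) (c := 12) one_pos (by norm_num) 3
  norm_num at h
  have h7 := heegnerTau_seven_mul (a := 7) (b := -6) (c := 3) (by norm_num) (by norm_num)
  norm_num at h7
  rw [h, h7, ← formJ_eq_kleinJ]
  have e := formJ_eq_formJ_act ⟨7, -6, 3⟩ (by norm_num) (by norm_num [BinQF.disc]) (p := 0) (q := -1)
    (r := 1) (s := -1) (by norm_num)
  simpa [BinQF.act] using e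

/-- `j((τ_{(1,0,12)} + 4)/7) = j(τ_{(49,-56,28)}) = j(τ_{(7,-8,4)}) = j(τ_{(3,0,4)})` (`D = -48`).
[cite: Cox2013, §11.B Lemma 11.24 and §11.A Thm. 11.2] -/
theorem conj_4_neg48 : kleinJ (divPoint 7 4 (heegnerTau (1, 0, 12))) = formJ (3, 0, 4) := by
  have h := divPoint_seven_heegnerTau_of_pos (a := 1) (b := 0) (c := 12) one_pos (by norm_num) 4
  norm_num at h
  have h7 := heegnerTau_seven_mul (a := 7) (b := -8) (c := 4) (by norm_num) (by norm_num)
  norm_num at h7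
  rw [h, h7, ← formJ_eq_kleinJ]
  have e := formJ_eq_formJ_act ⟨7, -8, 4⟩ (by norm_num) (by norm_num [BinQF.disc]) (p := -1) (q := 0)
    (r := -1) (s := -1) (by norm_num)
  simpa [BinQF.act] using e

/-- `j((τ_{(3,0,4)} + 1)/7) = j(τ_{(147,-42,7)}) = j(τ_{(21,-6,1)}) = j(τ_{(1,0,12)})` (`D = -48`).
[cite: Cox2013, §11.B Lemma 11.24 and §11.A Thm. 11.2] -/
theorem conj_1_neg48' : kleinJ (divPoint 7 1 (heegnerTau (3, 0, 4))) = formJ (1, 0, 12) := by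
  have h := divPoint_seven_heegnerTau_of_pos (a := 3) (b := 0) (c := 4) (by norm_num) (by norm_num) 1
  norm_num at h
  have h7 := heegnerTau_seven_mul (a := 21) (b := -6) (c := 1) (by norm_num) (by norm_num)
  norm_num at h7
  rw [h, h7, ← formJ_eq_kleinJ]
  have e := formJ_eq_formJ_act ⟨21, -6, 1⟩ (by norm_num) (by norm_num [BinQF.disc]) (p := 0) (q := -1)
    (r := 1) (s := -3) (by norm_num)
  simpa [BinQF.act] using e

/-- `j((τ_{(3,0,4)} + 6)/7) = j(τ_{(147,-252,112)}) = j(τ_{(21,-36,16)}) = j(τ_{(1,0,12)})` (`D = -48`).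
[cite: Cox2013, §11.B Lemma 11.24 and §11.A Thm. 11.2] -/
theorem conj_6_neg48' : kleinJ (divPoint 7 6 (heegnerTau (3, 0, 4))) = formJ (1, 0, 12) := by
  have h := divPoint_seven_heegnerTau_of_pos (a := 3) (b := 0) (c := 4) (by norm_num) (by norm_num) 6
  norm_num at h
  have h7 := heegnerTau_seven_mul (a := 21) (b := -36) (c := 16) (by norm_num) (by norm_num)
  norm_num at h7
  rw [h, h7, ← formJ_eq_kleinJ]
  have e := formJ_eq_formJ_act ⟨21, -36, 16⟩ (by norm_num) (by norm_num [BinQF.disc]) (p := -1) (q := -2)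
    (r := -1) (s := -3) (by norm_num)
  simpa [BinQF.act] using e

/-- **`Φ₇(j(τ_{(3,0,4)}), j(τ_{(1,0,12)})) = 0`** (`D = -48`), moduli as atoms `formJ`. [cite: Cox2013, §11.B (11.15) and Lemma 11.24] -/
theorem rel_neg48 : (((intModularPolynomial 7).map (mapRingHom (Int.castRingHom ℂ))).map
    (evalRingHom (formJ (1, 0, 12)))).eval (formJ (3, 0, 4)) = 0 := by
  have h := intModularPolynomial_kleinJ_divPoint 7 3 (heegnerTau (1, 0, 12))
  rwa [conj_3_neg48, ← formJ_eq_kleinJ] at h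

/-- **`Φ₇(j(τ_{(1,0,12)}), j(τ_{(3,0,4)})) = 0`** (`D = -48`), moduli as atoms `formJ`. [cite: Cox2013, §11.B (11.15) and Lemma 11.24] -/
theorem rel_neg48' : (((intModularPolynomial 7).map (mapRingHom (Int.castRingHom ℂ))).map
    (evalRingHom (formJ (3, 0, 4)))).eval (formJ (1, 0, 12)) = 0 := by
  have h := intModularPolynomial_kleinJ_divPoint 7 1 (heegnerTau (3, 0, 4))
  rwa [conj_1_neg48', ← formJ_eq_kleinJ] at h

/-- **`∂Φ₇/∂X (j(τ_{(3,0,4)}), j(τ_{(1,0,12)})) = 0`** (`D = -48`): the cosets `k = 3, 4` of `τ_{(1,0,12)}` have the same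
modulus, so `j(τ_{(3,0,4)})` is a DOUBLE root of the fibre over `j(τ_{(1,0,12)})`. [cite: Cox2013, §11.B (11.14)–(11.15) and Lemma 11.24] -/
theorem drel_neg48 : (derivative (((intModularPolynomial 7).map (mapRingHom (Int.castRingHom ℂ))).map
    (evalRingHom (formJ (1, 0, 12))))).eval (formJ (3, 0, 4)) = 0 := by
  have h := derivative_fibre_eval_eq_zero_of_divPoint (p := 7) (k₁ := 3) (k₂ := 4) (τ := heegnerTau (1, 0, 12))
    (by norm_num) (by norm_num) (by norm_num) (conj_3_neg48.trans conj_4_neg48.symm)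
  rwa [conj_3_neg48, ← formJ_eq_kleinJ] at h

/-- **`∂Φ₇/∂X (j(τ_{(1,0,12)}), j(τ_{(3,0,4)})) = 0`** (`D = -48`): the cosets `k = 1, 6` of `τ_{(3,0,4)}` have the same
modulus, so `j(τ_{(1,0,12)})` is a DOUBLE root of the fibre over `j(τ_{(3,0,4)})`. [cite: Cox2013, §11.B (11.14)–(11.15) and Lemma 11.24] -/
theorem drel_neg48' : (derivative (((intModularPolynomial 7).map (mapRingHom (Int.castRingHom ℂ))).map
    (evalRingHom (formJ (3, 0, 4))))).eval (formJ (1, 0, 12)) = 0 := by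
  have h := derivative_fibre_eval_eq_zero_of_divPoint (p := 7) (k₁ := 1) (k₂ := 6) (τ := heegnerTau (3, 0, 4))
    (by norm_num) (by norm_num) (by norm_num) (conj_1_neg48'.trans conj_6_neg48'.symm)
  rwa [conj_1_neg48', ← formJ_eq_kleinJ] at h

/-! ### `D = -52`: forms `(1,0,13)` (principal) and `(2,2,7)` -/

/-- `j((τ_{(1,0,13)} + 1)/7) = j(τ_{(49,-14,14)}) = j(τ_{(7,-2,2)}) = j(τ_{(2,2,7)})` (`D = -52`).
[cite: Cox2013, §11.B Lemma 11.24 and §11.A Thm. 11.2] -/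
theorem conj_1_neg52 : kleinJ (divPoint 7 1 (heegnerTau (1, 0, 13))) = formJ (2, 2, 7) := by
  have h := divPoint_seven_heegnerTau_of_pos (a := 1) (b := 0) (c := 13) one_pos (by norm_num) 1
  norm_num at h
  have h7 := heegnerTau_seven_mul (a := 7) (b := -2) (c := 2) (by norm_num) (by norm_num)
  norm_num at h7
  rw [h, h7, ← formJ_eq_kleinJ]
  have e := formJ_eq_formJ_act ⟨7, -2, 2⟩ (by norm_num) (by norm_num [BinQF.disc]) (p := 0) (q := -1)
    (r := 1) (s := 0) (by norm_num)
  simpa [BinQF.act] using e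

/-- `j((τ_{(1,0,13)} + 6)/7) = j(τ_{(49,-84,49)}) = j(τ_{(7,-12,7)}) = j(τ_{(2,2,7)})` (`D = -52`).
[cite: Cox2013, §11.B Lemma 11.24 and §11.A Thm. 11.2] -/
theorem conj_6_neg52 : kleinJ (divPoint 7 6 (heegnerTau (1, 0, 13))) = formJ (2, 2, 7) := by
  have h := divPoint_seven_heegnerTau_of_pos (a := 1) (b := 0) (c := 13) one_pos (by norm_num) 6
  norm_num at h
  have h7 := heegnerTau_seven_mul (a := 7) (b := -12) (c := 7) (by norm_num) (by norm_num)
  norm_num at h7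
  rw [h, h7, ← formJ_eq_kleinJ]
  have e := formJ_eq_formJ_act ⟨7, -12, 7⟩ (by norm_num) (by norm_num [BinQF.disc]) (p := -1) (q := 0)
    (r := -1) (s := -1) (by norm_num)
  simpa [BinQF.act] using e

/-- `j((τ_{(2,2,7)} + 0)/7) = j(τ_{(98,14,7)}) = j(τ_{(14,2,1)}) = j(τ_{(1,0,13)})` (`D = -52`).
[cite: Cox2013, §11.B Lemma 11.24 and §11.A Thm. 11.2] -/
theorem conj_0_neg52' : kleinJ (divPoint 7 0 (heegnerTau (2, 2, 7))) = formJ (1, 0, 13) := by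
  have h := divPoint_seven_heegnerTau_of_pos (a := 2) (b := 2) (c := 7) (by norm_num) (by norm_num) 0
  norm_num at h
  have h7 := heegnerTau_seven_mul (a := 14) (b := 2) (c := 1) (by norm_num) (by norm_num)
  norm_num at h7
  rw [h, h7, ← formJ_eq_kleinJ]
  have e := formJ_eq_formJ_act ⟨14, 2, 1⟩ (by norm_num) (by norm_num [BinQF.disc]) (p := 0) (q := -1)
    (r := 1) (s := 1) (by norm_num)
  simpa [BinQF.act] using e

/-- `j((τ_{(2,2,7)} + 1)/7) = j(τ_{(98,-14,7)}) = j(τ_{(14,-2,1)}) = j(τ_{(1,0,13)})` (`D = -52`).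
[cite: Cox2013, §11.B Lemma 11.24 and §11.A Thm. 11.2] -/
theorem conj_1_neg52' : kleinJ (divPoint 7 1 (heegnerTau (2, 2, 7))) = formJ (1, 0, 13) := by
  have h := divPoint_seven_heegnerTau_of_pos (a := 2) (b := 2) (c := 7) (by norm_num) (by norm_num) 1
  norm_num at h
  have h7 := heegnerTau_seven_mul (a := 14) (b := -2) (c := 1) (by norm_num) (by norm_num)
  norm_num at h7
  rw [h, h7, ← formJ_eq_kleinJ]
  have e := formJ_eq_formJ_act ⟨14, -2, 1⟩ (by norm_num) (by norm_num [BinQF.disc]) (p := 0) (q := -1)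
    (r := 1) (s := -1) (by norm_num)
  simpa [BinQF.act] using e

/-- **`Φ₇(j(τ_{(2,2,7)}), j(τ_{(1,0,13)})) = 0`** (`D = -52`), moduli as atoms `formJ`. [cite: Cox2013, §11.B (11.15) and Lemma 11.24] -/
theorem rel_neg52 : (((intModularPolynomial 7).map (mapRingHom (Int.castRingHom ℂ))).map
    (evalRingHom (formJ (1, 0, 13)))).eval (formJ (2, 2, 7)) = 0 := by
  have h := intModularPolynomial_kleinJ_divPoint 7 1 (heegnerTau (1, 0, 13))
  rwa [conj_1_neg52, ← formJ_eq_kleinJ] at h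

/-- **`Φ₇(j(τ_{(1,0,13)}), j(τ_{(2,2,7)})) = 0`** (`D = -52`), moduli as atoms `formJ`. [cite: Cox2013, §11.B (11.15) and Lemma 11.24] -/
theorem rel_neg52' : (((intModularPolynomial 7).map (mapRingHom (Int.castRingHom ℂ))).map
    (evalRingHom (formJ (2, 2, 7)))).eval (formJ (1, 0, 13)) = 0 := by
  have h := intModularPolynomial_kleinJ_divPoint 7 0 (heegnerTau (2, 2, 7))
  rwa [conj_0_neg52', ← formJ_eq_kleinJ] at h

/-- **`∂Φ₇/∂X (j(τ_{(2,2,7)}), j(τ_{(1,0,13)})) = 0`** (`D = -52`): the cosets `k = 1, 6` of `τ_{(1,0,13)}` have the same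
modulus, so `j(τ_{(2,2,7)})` is a DOUBLE root of the fibre over `j(τ_{(1,0,13)})`. [cite: Cox2013, §11.B (11.14)–(11.15) and Lemma 11.24] -/
theorem drel_neg52 : (derivative (((intModularPolynomial 7).map (mapRingHom (Int.castRingHom ℂ))).map
    (evalRingHom (formJ (1, 0, 13))))).eval (formJ (2, 2, 7)) = 0 := by
  have h := derivative_fibre_eval_eq_zero_of_divPoint (p := 7) (k₁ := 1) (k₂ := 6) (τ := heegnerTau (1, 0, 13))
    (by norm_num) (by norm_num) (by norm_num) (conj_1_neg52.trans conj_6_neg52.symm)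
  rwa [conj_1_neg52, ← formJ_eq_kleinJ] at h

/-- **`∂Φ₇/∂X (j(τ_{(1,0,13)}), j(τ_{(2,2,7)})) = 0`** (`D = -52`): the cosets `k = 0, 1` of `τ_{(2,2,7)}` have the same
modulus, so `j(τ_{(1,0,13)})` is a DOUBLE root of the fibre over `j(τ_{(2,2,7)})`. [cite: Cox2013, §11.B (11.14)–(11.15) and Lemma 11.24] -/
theorem drel_neg52' : (derivative (((intModularPolynomial 7).map (mapRingHom (Int.castRingHom ℂ))).map
    (evalRingHom (formJ (2, 2, 7))))).eval (formJ (1, 0, 13)) = 0 := by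
  have h := derivative_fibre_eval_eq_zero_of_divPoint (p := 7) (k₁ := 0) (k₂ := 1) (τ := heegnerTau (2, 2, 7))
    (by norm_num) (by norm_num) (by norm_num) (conj_0_neg52'.trans conj_1_neg52'.symm)
  rwa [conj_0_neg52', ← formJ_eq_kleinJ] at h

/-! ### `D = -75`: forms `(1,1,19)` (principal) and `(3,3,7)` — one coset and the value relation only -/

/-- `j((τ_{(1,1,19)} + 2)/7) = j(τ_{(49,-21,21)}) = j(τ_{(7,-3,3)}) = j(τ_{(3,3,7)})` (`D = -75`).
[cite: Cox2013, §11.B Lemma 11.24 and §11.A Thm. 11.2] -/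
theorem conj_2_neg75 : kleinJ (divPoint 7 2 (heegnerTau (1, 1, 19))) = formJ (3, 3, 7) := by
  have h := divPoint_seven_heegnerTau_of_pos (a := 1) (b := 1) (c := 19) one_pos (by norm_num) 2
  norm_num at h
  have h7 := heegnerTau_seven_mul (a := 7) (b := -3) (c := 3) (by norm_num) (by norm_num)
  norm_num at h7
  rw [h, h7, ← formJ_eq_kleinJ]
  have e := formJ_eq_formJ_act ⟨7, -3, 3⟩ (by norm_num) (by norm_num [BinQF.disc]) (p := 0) (q := -1)
    (r := 1) (s := 0) (by norm_num)
  simpa [BinQF.act] using e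

/-- **`Φ₇(j(τ_{(3,3,7)}), j(τ_{(1,1,19)})) = 0`** (`D = -75`), moduli as atoms `formJ`. [cite: Cox2013, §11.B (11.15) and Lemma 11.24] -/
theorem rel_neg75 : (((intModularPolynomial 7).map (mapRingHom (Int.castRingHom ℂ))).map
    (evalRingHom (formJ (1, 1, 19)))).eval (formJ (3, 3, 7)) = 0 := by
  have h := intModularPolynomial_kleinJ_divPoint 7 2 (heegnerTau (1, 1, 19))
  rwa [conj_2_neg75, ← formJ_eq_kleinJ] at h

end ModularPolynomialSeven
end Literature.NumberTheory.EllipticCurves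
end
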